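import Literature.MathematicalPhysics.QuantumFieldTheory.Balaban1983to89.T4HistoryLipschitzCubeGeometry
import Summits.QuantumFields.BalabanUV.T4Continuum.Support.NE9MarginalProjectionEnd
import Summits.QuantumFields.BalabanUV.T4Continuum.Support.B13CarriersCubeChart

/-!
# T⁴ programme, spine estimate NE9 (node U3, history side) — the MARGINAL-PROJECTION END faces (`T := 𝒯 ∘ P`) OVER A CUBE
# CHART and ON THE CARRIERS OF RECORD (crew row (w12) rider (b) of the row owner's ruling)

NE9 formalisation swarm `t4-ne9-formalise-*` (cell `pub-balaban`), seat `b2b-balaban-t4-ne9-formalise-leaf-02-g2` (LEAF PROVER 02,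
gen 2); sibling of `Spine/NE9/CarriersOfRecordFaces` (crew row (w12) = micro-item G-REC, p209434).  The row owner's ruling (journal
2026-08-20T06:44:46Z, skeleton `t4/b2b-balaban-t4-ne9-p1/SKELETON-NE9-P1.md` v1.3.3) accepted (w12) with the rider «add, in the same file
or a sibling, the two NEW faces `NE9MarginalProjectionEnd.ne9_and_fadingMemory_of_couplingTwoPoint_vacSub_sizeInduction_compProj` ∕
`…_margProj` (T := 𝒯 ∘ P per O-ne9p1g22-1) on the same carriers».  This file is that sibling.  Summits-side NEW WORK (bookkeeping
only) under the LEAN PLACEMENT RULE; nothing imported is edited, every END face is APPLIED BY NAME.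

WHY.  After the owner's v1.3 correction (GAPS O-ne9p1g22-1) the history channel of the one-step cluster representation is fed
MARGINAL-FREE old terms: the END faces of record are `NE9MarginalProjectionEnd.…_compProj` (channel `compProj 𝒯 P`, channel binders
S3∕S5 about `𝒯` ON THE MARGINAL-FREE CLASS `MF`, four projection binders, rate `ω + 8·lipbar·B·((1 + c)·τ̄)`) and `…_margProj`
(`P := margProj r A`, `c = cr·aA`, three projection binders DERIVED from the read-out's additivity∕zero∕size and the marginal
direction's size).  Both are stated over an ABSTRACT `G : ClusterGeom C` and display the geometry leaves L-G1 `hdec` ∕ L-G2 `hpin`.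
§1 composes them with road P2's cube-chart theorems `CubeChart.decayExtract` ∕ `CubeChart.pinBudget` for ANY chart
`Γ : CubeChart C α adj D` (L-G1∕L-G2 GONE: size weights `sizeWeight a₁`∕`sizeWeight d₁` per cube, `δ X = d₁·#cubes X`, pin budget
`B = a₁`, scalars `0 ≤ a₁`, `0 ≤ κ ≤ d₁`); §2 specialises §1 to NE9's chart ON THE CARRIERS OF RECORD,
`Γ := B13CarriersCubeChart.cubeChart R` (`R : B13Carriers.TwoRuns G`): the marginal-projection END faces for term functionals
`E : Functional R.carriers Bg` on the SAME `Carriers` as row NE5's END faces (node U3's `T4OutputRate.u3_threeBrackets`).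

CUBE-CURRENCY RIDER (owner ruling (1)(a); FINDING F-ne9leaf01-1, kernel `Support/NE9CubeCurrencyBudget` p208845).  The faces below
discharge L-G1∕L-G2 with road P2's CUBE-COUNT producers: decay weight `d₁` PER CUBE with `κ ≤ d₁`, pin budget `a₁` per cube.  Any
producer of the remaining Kotecký–Preiss binder `hK` in the same currency (the E2∕E5-type binders `hθ`, `hεθ`, `hθ₁`, `hliplb` of
`T4HistoryLipschitzLinearSize` ∕ `NE9PrintedMajorantDecay`) then pays (R) the RATE DIVISION `κ ≤ a′∕2^ν − a₁ − 1 − log(2D)` and (P)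
the factor `e^{a(1−2^{−ν}) + a′(1−2^{−ν})}` in the fading product (`NE9CubeCurrencyBudget.rate_budget` ∕ `fade_necessary`) — located
costs of the cube currency, not of the mathematics; the d-currency producers of crew row (w13) (F8: `Support/NE9LinSizeKP`,
`NE9LinSizeEntropy`, `NE9LinSizePinned` and the composition) remove them.  Until (w13) lands, every use of these faces inherits (R)∕(P).

WHAT IS PROVED (kernel; each theorem a one-line application BY NAME):
* §1 `cubeChart_termSize_ne9_and_fadingMemory_of_couplingTwoPoint_vacSub_sizeInduction_compProj` ∕ `…_margProj` — the two faces at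
  `G := Γ.geom`, `a := Γ.supported.sizeWeight a₁`, `d := Γ.supported.sizeWeight d₁`, binders `hdec`∕`hpin`∕`hB` REPLACED by
  `ha₁ : 0 ≤ a₁`, `hκ : 0 ≤ κ`, `hκd : κ ≤ d₁`; conclusions LITERALLY `TermSize E W κ N ∧ NE9 E W κ (prodModuli (8·clipbar·a₁ +
  8·lipbar·a₁·qTbar) fun _ => ω + 8·lipbar·a₁·((1 + c)·τbar)) ∧ FadingMemory (…) (…) (…)` (`c = cr·aA` for `…_margProj`).
* §2 `rec_termSize_ne9_and_fadingMemory_of_couplingTwoPoint_vacSub_sizeInduction_compProj` ∕ `…_margProj` — §1 at `cubeChart R`.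
Every other binder DISPLAYED VERBATIM: L-O1 (activities, channel `𝒯`, reading `ρ`, tables, majorant — NODE O, constructed by nobody
yet), L-S1∕L-S2, the projection binders (MP), S3∕S5 on the marginal-free class (S5-MF, [II] Lemma 1 (1.36) TYPE — displayed, c3),
L-S4 (vacuum-subtracted representation), L-A1…L-A3, L-R1, the one-run size data (B0)∕(XZ)∕(N′)∕(R′), L-N1.  Trigger c3 respected:
no `def … : Prop` minted; the (R-1) chain is asserted by nobody; nothing printed is used as a hypothesis-free fact; constants
symbolic (c6; `cr` = node U2's read-out constant, NOT PRINTED, GAPS C-ne4p1-7; `aA` = one-cube Wilson action bound, with O1).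

HONEST FRAMING: rung (B)+1 bookkeeping on a FIXED finite four-torus.  Headline discipline (ruling (1)(c)): «L-G1∕L-G2 inhabited on
the carriers of record (cube currency)» — never «NE9 instantiated»: the activities ∕ channel ∕ tables of [II] §2 are untyped (O1).
NE9 is NOT PRINTED and NOT PROVED — every headline reads «NE9 ⇐ the named binders»; NOT UV stability, NOT the continuum limit by
itself, NOT infinite volume, NOT a mass gap, NOT Clay; spine PROVED 0∕9 unchanged.  HONEST DEPENDENCY: continuum YM on T⁴ ⇐ BetaPertH
∧ nine spine estimates (0/9 proved); BetaPertH ⇐ (D1) ∧ (D4) ∧ CAP+tail; G-an2-4 gates asym, D1 and NE2/3/4.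

References (TYPES∕STRUCTURE only): [I] = [Balaban1987RG1] (0.27)–(0.30) p.258, (1.3) p.260, (1.18) p.263, (1.20)–(1.22) p.264,
(2.12)–(2.14) p.268; [II] = [Balaban1988RG2Cluster] p.8 l.9–10, (1.36) p.9, (2.27) p.18, (2.30) p.18, Lemma 3 (2.38) p.20,
(2.40)–(2.41) p.21; [KoteckyPreiss1986] (1)–(4) p.492.
-/

noncomputable section

namespace Summit.QuantumFields.BalabanUV.T4Continuum.NE9.CarriersOfRecordFacesProj

open scoped BigOperators
open Literature.MathematicalPhysics.QuantumFieldTheory.Balaban1983to89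
open Literature.MathematicalPhysics.QuantumFieldTheory.Balaban1983to89.T4OutputRate
open Literature.MathematicalPhysics.QuantumFieldTheory.Balaban1983to89.T4HistoryLipschitzRecursion
open Literature.MathematicalPhysics.QuantumFieldTheory.Balaban1983to89.T4HistoryLipschitzOuter
open Literature.MathematicalPhysics.QuantumFieldTheory.Balaban1983to89.T4HistoryLipschitzActivity
open Literature.MathematicalPhysics.QuantumFieldTheory.Balaban1983to89.T4HistoryLipschitzActivity (ClusterGeom)
open Literature.MathematicalPhysics.QuantumFieldTheory.Balaban1983to89.T4HistoryLipschitzEntropy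
open Literature.MathematicalPhysics.QuantumFieldTheory.Balaban1983to89.T4HistoryLipschitzSegment
open Literature.MathematicalPhysics.QuantumFieldTheory.Balaban1983to89.T4HistoryLipschitzCubeGeometry (CubeChart)
open Summit.QuantumFields.BalabanUV.T4Continuum.NE9MarginalProjection
open Summit.QuantumFields.BalabanUV.T4Continuum.NE9MarginalProjectionEnd
open Summit.QuantumFields.BalabanUV.T4Continuum.B13Carriers (TwoRuns)
open Summit.QuantumFields.BalabanUV.T4Continuum.B13DomainGeometryTR (SCube SAdj)
open Summit.QuantumFields.BalabanUV.T4Continuum.B13CarriersCubeChart (cubeChart)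

/-! ## §1 The two marginal-projection END faces over a CUBE CHART (L-G1∕L-G2 discharged) -/

section AnyChart

variable {C : Carriers} {Bg ι : Type} {Pot : Type*} [NormedAddCommGroup Pot] [NormedSpace ℂ Pot]
  {α : Type} [DecidableEq α] {adj : α → α → Prop} [DecidableRel adj] [Std.Symm adj] {D : ℕ}

/-- **THE `compProj` FACE OVER A CUBE CHART** [bookkeeping] —
`NE9MarginalProjectionEnd.ne9_and_fadingMemory_of_couplingTwoPoint_vacSub_sizeInduction_compProj` at `G := Γ.geom` with cube-count
size weights: channel `compProj 𝒯 P` (binders S3∕S5 about `𝒯` on the marginal-free class `MF`, four projection binders), L-G1∕L-G2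
DISCHARGED by `CubeChart.decayExtract` ∕ `CubeChart.pinBudget` (scalars `0 ≤ a₁`, `0 ≤ κ ≤ d₁`; pin budget `B = a₁`), rate
`ω + 8·lipbar·a₁·((1 + c)·τbar)`.  Cube currency (header rider). -/
theorem cubeChart_termSize_ne9_and_fadingMemory_of_couplingTwoPoint_vacSub_sizeInduction_compProj (Γ : CubeChart C α adj D)
    {E : Functional C Bg} {W : Set (ℕ → ℝ)} {Adm MF : Set (Bg → C.Dom → ℝ)}
    {P : (Bg → C.Dom → ℝ) → (Bg → C.Dom → ℝ)} {𝒯 : ℕ → (ℕ → ℝ) → (Bg → C.Dom → ℝ) → ι → ℝ}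
    {Ψ : ℕ → ℝ → (ι → ℝ) → Bg → C.Dom → ℝ} {act : ℕ → ℝ → Bg → Pot → Γ.geom.P → ℂ} {𝒜 : ℕ → Set Pot}
    {n : ℕ → ℝ → Bg → Γ.geom.P → ℝ} {lip clip : ℕ → ℝ}
    {a₁ d₁ κ lipbar clipbar qTbar τbar ω c : ℝ} {wt : ℕ → ι → ℝ} {τ : ℕ → ℕ → ℝ} {qT p₀ N : ℕ → ℝ}
    (ρ : ℕ → (ι → ℝ) → Pot) (U₀ : Bg) (explZ : ℕ → Bg → C.Dom → ℝ)
    -- L-S1, L-S2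
    (h0 : ScaleZeroFree E W) (hAdm : AdmissibleTerms E W Adm) (hres : AdmRestrict Adm)
    -- MP: the projection binders; S3 ∕ S5-MF: the channel binders ON THE MARGINAL-FREE CLASS
    (hPadd : ProjAdditive Adm P) (hPcomm : ProjScaleComm Adm P) (hPinto : ProjInto Adm MF P) (hPsize : ProjSize Adm P κ c)
    (hc : 0 ≤ c) (hadd : ChannelAdditive MF 𝒯) (hsum : ChannelStepSum MF 𝒯) (hstep : ChannelSizeAtStepNN MF 𝒯 κ wt τ)
    -- L-S4 (vacuum-subtracted representation) at `T := 𝒯 ∘ P`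
    (hfac : Factorises E W (compProj 𝒯 P) Ψ)
    (hreprV : ∀ (k : ℕ) (s : ℝ) (Q : ι → ℝ) (U : Bg) (X : C.Dom),
      Ψ k s Q U X = (Γ.geom.newTerm act k s U X (ρ k Q)).re - (Γ.geom.newTerm act k s U₀ X (ρ k Q)).re + explZ k U X)
    -- L-A1 with cube-count size weights
    (hK : TwoPointKP Γ.geom W act 𝒜 n lip (Γ.supported.sizeWeight a₁) (Γ.supported.sizeWeight d₁))
    (hlipb : ∀ k, lip k ≤ lipbar)
    -- L-A2
    (hclip0 : ∀ k, 0 ≤ clip k)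
    (hCup : ∀ g ∈ W, ∀ g' ∈ W, ∀ (k : ℕ) (U : Bg) (X : C.Dom), C.scale X = k + 1 → ∀ Q ∈ 𝒜 k, ∀ γ ∈ Γ.geom.vol X,
      ‖act k (g k) U Q γ‖ ≤ n k (g' k) U γ ∧
        ‖act k (g k) U Q γ - act k (g' k) U Q γ‖ ≤ clip k * |g k - g' k| * n k (g' k) U γ)
    (hclipb : ∀ k, clip k ≤ clipbar)
    -- L-A3 at `T := 𝒯 ∘ P`
    (hqT0 : ∀ k, 0 ≤ qT k)
    (hTcup : ∀ g ∈ W, ∀ g' ∈ W, ∀ (k : ℕ) (y : ι),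
      |compProj 𝒯 P k g (E g) y - compProj 𝒯 P k g' (E g) y| ≤ wt k y * (qT k * |g k - g' k|))
    (hqTb : ∀ k, qT k ≤ qTbar)
    -- L-G1 ∕ L-G2 DISCHARGED on the chart
    (ha₁ : 0 ≤ a₁) (hκ : 0 ≤ κ) (hκd : κ ≤ d₁)
    -- L-R1
    (hρ : ∀ (k : ℕ) (Q Q' : ι → ℝ) (M : ℝ), (∀ y, |Q y - Q' y| ≤ wt k y * M) → ‖ρ k Q - ρ k Q'‖ ≤ M)
    -- (B0), (XZ), (N′), (R′) with the projected weights `(1 + c)·τ`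
    (hexplZ : ∀ (k : ℕ) (U : Bg) (X : C.Dom), C.scale X = k + 1 → |explZ k U X| ≤ Real.exp (-(κ * C.d X)) * p₀ k)
    (hbase : ∀ g ∈ W, ∀ (U : Bg) (X : C.Dom), C.scale X = 0 → |E g U X| ≤ Real.exp (-(κ * C.d X)) * N 0)
    (hNsucc : ∀ j, p₀ j + 2 * a₁ ≤ N (j + 1)) (hNnn : ∀ j, 0 ≤ N j)
    (hbox : ∀ (k : ℕ) (Q : ι → ℝ), (∀ y, |Q y| ≤ wt k y * sizeRadius (fun k j => (1 + c) * τ k j) N k) → ρ k Q ∈ 𝒜 k)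
    -- L-N1
    (hτbar : 0 ≤ τbar) (hω : 0 ≤ ω) (hpos : 0 < ω + 8 * lipbar * a₁ * ((1 + c) * τbar))
    (hτ : ∀ k j, j ≤ k → 0 ≤ τ k j ∧ τ k j ≤ τbar * ω ^ (k - j)) :
    TermSize E W κ N ∧
      NE9 E W κ (prodModuli (8 * clipbar * a₁ + 8 * lipbar * a₁ * qTbar)
        fun _ => ω + 8 * lipbar * a₁ * ((1 + c) * τbar)) ∧
        FadingMemory ((8 * clipbar * a₁ + 8 * lipbar * a₁ * qTbar) / (ω + 8 * lipbar * a₁ * ((1 + c) * τbar)))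
          (ω + 8 * lipbar * a₁ * ((1 + c) * τbar))
          (prodModuli (8 * clipbar * a₁ + 8 * lipbar * a₁ * qTbar) fun _ => ω + 8 * lipbar * a₁ * ((1 + c) * τbar)) :=
  ne9_and_fadingMemory_of_couplingTwoPoint_vacSub_sizeInduction_compProj Γ.geom ρ U₀ explZ h0 hAdm hres hPadd hPcomm hPinto
    hPsize hc hadd hsum hstep hfac hclip0 hCup hqT0 hTcup hreprV hclipb hqTb hK (Γ.decayExtract (hκ.trans hκd))
    (Γ.pinBudget ha₁ hκ hκd) hρ hexplZ hbase hNsucc hNnn hbox ha₁ hlipb hτbar hω hpos hτ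

/-- **THE `margProj` FACE OVER A CUBE CHART** [bookkeeping] —
`NE9MarginalProjectionEnd.ne9_and_fadingMemory_of_couplingTwoPoint_vacSub_sizeInduction_margProj` at `G := Γ.geom` with cube-count
size weights: `P := margProj r A`, `c = cr·aA` (read-out additivity∕zero∕size + the marginal direction's size; `ProjInto` displayed),
L-G1∕L-G2 DISCHARGED (scalars `0 ≤ a₁`, `0 ≤ κ ≤ d₁`; `B = a₁`).  Cube currency (header rider). -/
theorem cubeChart_termSize_ne9_and_fadingMemory_of_couplingTwoPoint_vacSub_sizeInduction_margProj (Γ : CubeChart C α adj D)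
    {E : Functional C Bg} {W : Set (ℕ → ℝ)} {Adm MF : Set (Bg → C.Dom → ℝ)}
    {r : ℕ → (Bg → C.Dom → ℝ) → ℝ} {A : Bg → C.Dom → ℝ} {𝒯 : ℕ → (ℕ → ℝ) → (Bg → C.Dom → ℝ) → ι → ℝ}
    {Ψ : ℕ → ℝ → (ι → ℝ) → Bg → C.Dom → ℝ} {act : ℕ → ℝ → Bg → Pot → Γ.geom.P → ℂ} {𝒜 : ℕ → Set Pot}
    {n : ℕ → ℝ → Bg → Γ.geom.P → ℝ} {lip clip : ℕ → ℝ}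
    {a₁ d₁ κ lipbar clipbar qTbar τbar ω cr aA : ℝ} {wt : ℕ → ι → ℝ} {τ : ℕ → ℕ → ℝ} {qT p₀ N : ℕ → ℝ}
    (ρ : ℕ → (ι → ℝ) → Pot) (U₀ : Bg) (explZ : ℕ → Bg → C.Dom → ℝ)
    -- L-S1, L-S2
    (h0 : ScaleZeroFree E W) (hAdm : AdmissibleTerms E W Adm) (hres : AdmRestrict Adm)
    -- RO ∕ AW ∕ MP: the read-out, the marginal direction, the marginal-free class; S3 ∕ S5-MF on `MF`
    (hrA : ReadAdditive Adm r) (hr0 : ReadZero r) (hrs : ReadSize Adm r κ cr) (hA : DirSize A κ aA) (hcr : 0 ≤ cr)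
    (haA : 0 ≤ aA) (hPinto : ProjInto Adm MF (margProj r A))
    (hadd : ChannelAdditive MF 𝒯) (hsum : ChannelStepSum MF 𝒯) (hstep : ChannelSizeAtStepNN MF 𝒯 κ wt τ)
    -- L-S4 at `T := 𝒯 ∘ margProj r A`
    (hfac : Factorises E W (compProj 𝒯 (margProj r A)) Ψ)
    (hreprV : ∀ (k : ℕ) (s : ℝ) (Q : ι → ℝ) (U : Bg) (X : C.Dom),
      Ψ k s Q U X = (Γ.geom.newTerm act k s U X (ρ k Q)).re - (Γ.geom.newTerm act k s U₀ X (ρ k Q)).re + explZ k U X)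
    -- L-A1 with cube-count size weights
    (hK : TwoPointKP Γ.geom W act 𝒜 n lip (Γ.supported.sizeWeight a₁) (Γ.supported.sizeWeight d₁))
    (hlipb : ∀ k, lip k ≤ lipbar)
    -- L-A2
    (hclip0 : ∀ k, 0 ≤ clip k)
    (hCup : ∀ g ∈ W, ∀ g' ∈ W, ∀ (k : ℕ) (U : Bg) (X : C.Dom), C.scale X = k + 1 → ∀ Q ∈ 𝒜 k, ∀ γ ∈ Γ.geom.vol X,
      ‖act k (g k) U Q γ‖ ≤ n k (g' k) U γ ∧
        ‖act k (g k) U Q γ - act k (g' k) U Q γ‖ ≤ clip k * |g k - g' k| * n k (g' k) U γ)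
    (hclipb : ∀ k, clip k ≤ clipbar)
    -- L-A3 at `T := 𝒯 ∘ margProj r A`
    (hqT0 : ∀ k, 0 ≤ qT k)
    (hTcup : ∀ g ∈ W, ∀ g' ∈ W, ∀ (k : ℕ) (y : ι),
      |compProj 𝒯 (margProj r A) k g (E g) y - compProj 𝒯 (margProj r A) k g' (E g) y| ≤
        wt k y * (qT k * |g k - g' k|))
    (hqTb : ∀ k, qT k ≤ qTbar)
    -- L-G1 ∕ L-G2 DISCHARGED on the chart
    (ha₁ : 0 ≤ a₁) (hκ : 0 ≤ κ) (hκd : κ ≤ d₁)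
    -- L-R1
    (hρ : ∀ (k : ℕ) (Q Q' : ι → ℝ) (M : ℝ), (∀ y, |Q y - Q' y| ≤ wt k y * M) → ‖ρ k Q - ρ k Q'‖ ≤ M)
    -- (B0), (XZ), (N′), (R′) with the projected weights `(1 + cr·aA)·τ`
    (hexplZ : ∀ (k : ℕ) (U : Bg) (X : C.Dom), C.scale X = k + 1 → |explZ k U X| ≤ Real.exp (-(κ * C.d X)) * p₀ k)
    (hbase : ∀ g ∈ W, ∀ (U : Bg) (X : C.Dom), C.scale X = 0 → |E g U X| ≤ Real.exp (-(κ * C.d X)) * N 0)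
    (hNsucc : ∀ j, p₀ j + 2 * a₁ ≤ N (j + 1)) (hNnn : ∀ j, 0 ≤ N j)
    (hbox : ∀ (k : ℕ) (Q : ι → ℝ),
      (∀ y, |Q y| ≤ wt k y * sizeRadius (fun k j => (1 + cr * aA) * τ k j) N k) → ρ k Q ∈ 𝒜 k)
    -- L-N1
    (hτbar : 0 ≤ τbar) (hω : 0 ≤ ω) (hpos : 0 < ω + 8 * lipbar * a₁ * ((1 + cr * aA) * τbar))
    (hτ : ∀ k j, j ≤ k → 0 ≤ τ k j ∧ τ k j ≤ τbar * ω ^ (k - j)) :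
    TermSize E W κ N ∧
      NE9 E W κ (prodModuli (8 * clipbar * a₁ + 8 * lipbar * a₁ * qTbar)
        fun _ => ω + 8 * lipbar * a₁ * ((1 + cr * aA) * τbar)) ∧
        FadingMemory ((8 * clipbar * a₁ + 8 * lipbar * a₁ * qTbar) / (ω + 8 * lipbar * a₁ * ((1 + cr * aA) * τbar)))
          (ω + 8 * lipbar * a₁ * ((1 + cr * aA) * τbar))
          (prodModuli (8 * clipbar * a₁ + 8 * lipbar * a₁ * qTbar)
            fun _ => ω + 8 * lipbar * a₁ * ((1 + cr * aA) * τbar)) :=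
  ne9_and_fadingMemory_of_couplingTwoPoint_vacSub_sizeInduction_margProj Γ.geom ρ U₀ explZ h0 hAdm hres hrA hr0 hrs hA hcr haA
    hPinto hadd hsum hstep hfac hclip0 hCup hqT0 hTcup hreprV hclipb hqTb hK (Γ.decayExtract (hκ.trans hκd))
    (Γ.pinBudget ha₁ hκ hκd) hρ hexplZ hbase hNsucc hNnn hbox ha₁ hlipb hτbar hω hpos hτ

end AnyChart

/-! ## §2 ON THE CARRIERS OF RECORD: `Γ := B13CarriersCubeChart.cubeChart R` -/

section Record

variable {Gg : Type} [GaugeGroup Gg] (R : TwoRuns Gg) {Bg ι : Type} {Pot : Type*} [NormedAddCommGroup Pot]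
  [NormedSpace ℂ Pot]

/-- **THE `compProj` FACE ON THE CARRIERS OF RECORD** [bookkeeping] — §1's first face at `cubeChart R`: for every term functional
`E : Functional R.carriers Bg` (the SAME `Carriers` as row NE5's END faces), the marginal-projection END with L-G1∕L-G2 inhabited
(cube currency, header rider); the model O1, the projection binders, S3∕S5-MF, L-A1…L-A3, L-R1, (B0)∕(XZ)∕(N′)∕(R′), L-N1 displayed. -/
theorem rec_termSize_ne9_and_fadingMemory_of_couplingTwoPoint_vacSub_sizeInduction_compProj {E : Functional R.carriers Bg}
    {W : Set (ℕ → ℝ)} {Adm MF : Set (Bg → R.carriers.Dom → ℝ)}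
    {P : (Bg → R.carriers.Dom → ℝ) → (Bg → R.carriers.Dom → ℝ)} {𝒯 : ℕ → (ℕ → ℝ) → (Bg → R.carriers.Dom → ℝ) → ι → ℝ}
    {Ψ : ℕ → ℝ → (ι → ℝ) → Bg → R.carriers.Dom → ℝ} {act : ℕ → ℝ → Bg → Pot → (cubeChart R).geom.P → ℂ}
    {𝒜 : ℕ → Set Pot} {n : ℕ → ℝ → Bg → (cubeChart R).geom.P → ℝ} {lip clip : ℕ → ℝ}
    {a₁ d₁ κ lipbar clipbar qTbar τbar ω c : ℝ} {wt : ℕ → ι → ℝ} {τ : ℕ → ℕ → ℝ} {qT p₀ N : ℕ → ℝ}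
    (ρ : ℕ → (ι → ℝ) → Pot) (U₀ : Bg) (explZ : ℕ → Bg → R.carriers.Dom → ℝ)
    (h0 : ScaleZeroFree E W) (hAdm : AdmissibleTerms E W Adm) (hres : AdmRestrict Adm)
    (hPadd : ProjAdditive Adm P) (hPcomm : ProjScaleComm Adm P) (hPinto : ProjInto Adm MF P) (hPsize : ProjSize Adm P κ c)
    (hc : 0 ≤ c) (hadd : ChannelAdditive MF 𝒯) (hsum : ChannelStepSum MF 𝒯) (hstep : ChannelSizeAtStepNN MF 𝒯 κ wt τ)
    (hfac : Factorises E W (compProj 𝒯 P) Ψ)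
    (hreprV : ∀ (k : ℕ) (s : ℝ) (Q : ι → ℝ) (U : Bg) (X : R.carriers.Dom),
      Ψ k s Q U X = ((cubeChart R).geom.newTerm act k s U X (ρ k Q)).re -
        ((cubeChart R).geom.newTerm act k s U₀ X (ρ k Q)).re + explZ k U X)
    (hK : TwoPointKP (cubeChart R).geom W act 𝒜 n lip ((cubeChart R).supported.sizeWeight a₁)
      ((cubeChart R).supported.sizeWeight d₁))
    (hlipb : ∀ k, lip k ≤ lipbar) (hclip0 : ∀ k, 0 ≤ clip k)
    (hCup : ∀ g ∈ W, ∀ g' ∈ W, ∀ (k : ℕ) (U : Bg) (X : R.carriers.Dom), R.carriers.scale X = k + 1 → ∀ Q ∈ 𝒜 k,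
      ∀ γ ∈ (cubeChart R).geom.vol X,
        ‖act k (g k) U Q γ‖ ≤ n k (g' k) U γ ∧
          ‖act k (g k) U Q γ - act k (g' k) U Q γ‖ ≤ clip k * |g k - g' k| * n k (g' k) U γ)
    (hclipb : ∀ k, clip k ≤ clipbar) (hqT0 : ∀ k, 0 ≤ qT k)
    (hTcup : ∀ g ∈ W, ∀ g' ∈ W, ∀ (k : ℕ) (y : ι),
      |compProj 𝒯 P k g (E g) y - compProj 𝒯 P k g' (E g) y| ≤ wt k y * (qT k * |g k - g' k|))
    (hqTb : ∀ k, qT k ≤ qTbar)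
    -- L-G1 ∕ L-G2 INHABITED on the carriers of record: three scalars
    (ha₁ : 0 ≤ a₁) (hκ : 0 ≤ κ) (hκd : κ ≤ d₁)
    (hρ : ∀ (k : ℕ) (Q Q' : ι → ℝ) (M : ℝ), (∀ y, |Q y - Q' y| ≤ wt k y * M) → ‖ρ k Q - ρ k Q'‖ ≤ M)
    (hexplZ : ∀ (k : ℕ) (U : Bg) (X : R.carriers.Dom), R.carriers.scale X = k + 1 →
      |explZ k U X| ≤ Real.exp (-(κ * R.carriers.d X)) * p₀ k)
    (hbase : ∀ g ∈ W, ∀ (U : Bg) (X : R.carriers.Dom), R.carriers.scale X = 0 →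
      |E g U X| ≤ Real.exp (-(κ * R.carriers.d X)) * N 0)
    (hNsucc : ∀ j, p₀ j + 2 * a₁ ≤ N (j + 1)) (hNnn : ∀ j, 0 ≤ N j)
    (hbox : ∀ (k : ℕ) (Q : ι → ℝ), (∀ y, |Q y| ≤ wt k y * sizeRadius (fun k j => (1 + c) * τ k j) N k) → ρ k Q ∈ 𝒜 k)
    (hτbar : 0 ≤ τbar) (hω : 0 ≤ ω) (hpos : 0 < ω + 8 * lipbar * a₁ * ((1 + c) * τbar))
    (hτ : ∀ k j, j ≤ k → 0 ≤ τ k j ∧ τ k j ≤ τbar * ω ^ (k - j)) :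
    TermSize E W κ N ∧
      NE9 E W κ (prodModuli (8 * clipbar * a₁ + 8 * lipbar * a₁ * qTbar)
        fun _ => ω + 8 * lipbar * a₁ * ((1 + c) * τbar)) ∧
        FadingMemory ((8 * clipbar * a₁ + 8 * lipbar * a₁ * qTbar) / (ω + 8 * lipbar * a₁ * ((1 + c) * τbar)))
          (ω + 8 * lipbar * a₁ * ((1 + c) * τbar))
          (prodModuli (8 * clipbar * a₁ + 8 * lipbar * a₁ * qTbar) fun _ => ω + 8 * lipbar * a₁ * ((1 + c) * τbar)) :=
  cubeChart_termSize_ne9_and_fadingMemory_of_couplingTwoPoint_vacSub_sizeInduction_compProj (cubeChart R) ρ U₀ explZ h0 hAdm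
    hres hPadd hPcomm hPinto hPsize hc hadd hsum hstep hfac hreprV hK hlipb hclip0 hCup hclipb hqT0 hTcup hqTb ha₁ hκ hκd hρ
    hexplZ hbase hNsucc hNnn hbox hτbar hω hpos hτ

/-- **THE `margProj` FACE ON THE CARRIERS OF RECORD** [bookkeeping] — §1's second face at `cubeChart R`: the read-out projection
`margProj r A` (`c = cr·aA`; RO = node U2's read-out bound, AW = one-cube Wilson action bound, MP = `ProjInto` displayed) on
`R.carriers`, L-G1∕L-G2 inhabited (cube currency, header rider). -/
theorem rec_termSize_ne9_and_fadingMemory_of_couplingTwoPoint_vacSub_sizeInduction_margProj {E : Functional R.carriers Bg}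
    {W : Set (ℕ → ℝ)} {Adm MF : Set (Bg → R.carriers.Dom → ℝ)}
    {r : ℕ → (Bg → R.carriers.Dom → ℝ) → ℝ} {A : Bg → R.carriers.Dom → ℝ}
    {𝒯 : ℕ → (ℕ → ℝ) → (Bg → R.carriers.Dom → ℝ) → ι → ℝ}
    {Ψ : ℕ → ℝ → (ι → ℝ) → Bg → R.carriers.Dom → ℝ} {act : ℕ → ℝ → Bg → Pot → (cubeChart R).geom.P → ℂ}
    {𝒜 : ℕ → Set Pot} {n : ℕ → ℝ → Bg → (cubeChart R).geom.P → ℝ} {lip clip : ℕ → ℝ}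
    {a₁ d₁ κ lipbar clipbar qTbar τbar ω cr aA : ℝ} {wt : ℕ → ι → ℝ} {τ : ℕ → ℕ → ℝ} {qT p₀ N : ℕ → ℝ}
    (ρ : ℕ → (ι → ℝ) → Pot) (U₀ : Bg) (explZ : ℕ → Bg → R.carriers.Dom → ℝ)
    (h0 : ScaleZeroFree E W) (hAdm : AdmissibleTerms E W Adm) (hres : AdmRestrict Adm)
    (hrA : ReadAdditive Adm r) (hr0 : ReadZero r) (hrs : ReadSize Adm r κ cr) (hA : DirSize A κ aA) (hcr : 0 ≤ cr)
    (haA : 0 ≤ aA) (hPinto : ProjInto Adm MF (margProj r A))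
    (hadd : ChannelAdditive MF 𝒯) (hsum : ChannelStepSum MF 𝒯) (hstep : ChannelSizeAtStepNN MF 𝒯 κ wt τ)
    (hfac : Factorises E W (compProj 𝒯 (margProj r A)) Ψ)
    (hreprV : ∀ (k : ℕ) (s : ℝ) (Q : ι → ℝ) (U : Bg) (X : R.carriers.Dom),
      Ψ k s Q U X = ((cubeChart R).geom.newTerm act k s U X (ρ k Q)).re -
        ((cubeChart R).geom.newTerm act k s U₀ X (ρ k Q)).re + explZ k U X)
    (hK : TwoPointKP (cubeChart R).geom W act 𝒜 n lip ((cubeChart R).supported.sizeWeight a₁)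
      ((cubeChart R).supported.sizeWeight d₁))
    (hlipb : ∀ k, lip k ≤ lipbar) (hclip0 : ∀ k, 0 ≤ clip k)
    (hCup : ∀ g ∈ W, ∀ g' ∈ W, ∀ (k : ℕ) (U : Bg) (X : R.carriers.Dom), R.carriers.scale X = k + 1 → ∀ Q ∈ 𝒜 k,
      ∀ γ ∈ (cubeChart R).geom.vol X,
        ‖act k (g k) U Q γ‖ ≤ n k (g' k) U γ ∧
          ‖act k (g k) U Q γ - act k (g' k) U Q γ‖ ≤ clip k * |g k - g' k| * n k (g' k) U γ)
    (hclipb : ∀ k, clip k ≤ clipbar) (hqT0 : ∀ k, 0 ≤ qT k)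
    (hTcup : ∀ g ∈ W, ∀ g' ∈ W, ∀ (k : ℕ) (y : ι),
      |compProj 𝒯 (margProj r A) k g (E g) y - compProj 𝒯 (margProj r A) k g' (E g) y| ≤
        wt k y * (qT k * |g k - g' k|))
    (hqTb : ∀ k, qT k ≤ qTbar)
    -- L-G1 ∕ L-G2 INHABITED on the carriers of record: three scalars
    (ha₁ : 0 ≤ a₁) (hκ : 0 ≤ κ) (hκd : κ ≤ d₁)
    (hρ : ∀ (k : ℕ) (Q Q' : ι → ℝ) (M : ℝ), (∀ y, |Q y - Q' y| ≤ wt k y * M) → ‖ρ k Q - ρ k Q'‖ ≤ M)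
    (hexplZ : ∀ (k : ℕ) (U : Bg) (X : R.carriers.Dom), R.carriers.scale X = k + 1 →
      |explZ k U X| ≤ Real.exp (-(κ * R.carriers.d X)) * p₀ k)
    (hbase : ∀ g ∈ W, ∀ (U : Bg) (X : R.carriers.Dom), R.carriers.scale X = 0 →
      |E g U X| ≤ Real.exp (-(κ * R.carriers.d X)) * N 0)
    (hNsucc : ∀ j, p₀ j + 2 * a₁ ≤ N (j + 1)) (hNnn : ∀ j, 0 ≤ N j)
    (hbox : ∀ (k : ℕ) (Q : ι → ℝ),
      (∀ y, |Q y| ≤ wt k y * sizeRadius (fun k j => (1 + cr * aA) * τ k j) N k) → ρ k Q ∈ 𝒜 k)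
    (hτbar : 0 ≤ τbar) (hω : 0 ≤ ω) (hpos : 0 < ω + 8 * lipbar * a₁ * ((1 + cr * aA) * τbar))
    (hτ : ∀ k j, j ≤ k → 0 ≤ τ k j ∧ τ k j ≤ τbar * ω ^ (k - j)) :
    TermSize E W κ N ∧
      NE9 E W κ (prodModuli (8 * clipbar * a₁ + 8 * lipbar * a₁ * qTbar)
        fun _ => ω + 8 * lipbar * a₁ * ((1 + cr * aA) * τbar)) ∧
        FadingMemory ((8 * clipbar * a₁ + 8 * lipbar * a₁ * qTbar) / (ω + 8 * lipbar * a₁ * ((1 + cr * aA) * τbar)))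
          (ω + 8 * lipbar * a₁ * ((1 + cr * aA) * τbar))
          (prodModuli (8 * clipbar * a₁ + 8 * lipbar * a₁ * qTbar)
            fun _ => ω + 8 * lipbar * a₁ * ((1 + cr * aA) * τbar)) :=
  cubeChart_termSize_ne9_and_fadingMemory_of_couplingTwoPoint_vacSub_sizeInduction_margProj (cubeChart R) ρ U₀ explZ h0 hAdm
    hres hrA hr0 hrs hA hcr haA hPinto hadd hsum hstep hfac hreprV hK hlipb hclip0 hCup hclipb hqT0 hTcup hqTb ha₁ hκ hκd hρ
    hexplZ hbase hNsucc hNnn hbox hτbar hω hpos hτ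

end Record

end Summit.QuantumFields.BalabanUV.T4Continuum.NE9.CarriersOfRecordFacesProj

end
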